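import Mathlib.Analysis.MeanInequalitiesPow
import HarnessLib

/-!
# The deficient lever, Jensen step: total gain of a convex power over a family with known mean (stmt-Schanuel-6117)

Crux `stmt-Schanuel-6117` (`Summit.Schanuel.Schanuel.Theses.DiophantineDichotomy.ApproximationProperty`),
route `DiophantineDichotomy`, line `orbit-interpolation-determinant`, lead c8, registered sub-goal
`jensen_rpow_gain` (`--supports stmt-Schanuel-6117`; wave R1, the deficient-rank Galois-orbit
interpolation determinant, consumed by `orbitClusterBoundDeficient_of`).

Pure real analysis (all PROVED, no definitions, no named facts). In the deficient-rank interpolation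
determinant the cluster counts `k_τ ≥ 0` of the conjugate minors (indexed by the complex embeddings
`τ` of a Galois hull) have a known average `a`, and each minor gains `c₀ k_τ ^ p − k_τ` in the
exponent (`p = 1 + 1/t ≥ 1`, `c₀ ≥ 0`). The total gain is at least `card · (c₀ a ^ p − a)`:
this is the power-mean inequality (convexity of `x ↦ x ^ p` on `[0, ∞)`, Mathlib's
`Real.rpow_arith_mean_le_arith_mean_rpow` with the uniform weights `1 / card`).

* `JensenGain.card_mul_rpow_le_sum_rpow` — `card · a ^ p ≤ ∑ fᵢ ^ p` when `∑ fᵢ = card · a`,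
  `fᵢ ≥ 0`, `p ≥ 1`;
* `jensen_rpow_gain` (registered sub-goal, verbatim) —
  `card · (c₀ a ^ p − a) ≤ ∑ (c₀ fᵢ ^ p − fᵢ)`.

Sources: folklore (Jensen / power mean ≥ arithmetic mean), Mathlib `Mathlib.Analysis.MeanInequalitiesPow`.
-/

noncomputable section

-- `Summit.Schanuel.Schanuel.…` is the mandated summit/sub-problem namespace (single-conjunct summit), hence:
set_option linter.dupNamespace false

namespace Summit.Schanuel.Schanuel.Cruxes.ApproximationProperty.OrbitInterpolationDeterminant

open Finset
open scoped BigOperators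

namespace JensenGain

/-- **Power mean with uniform weights.** For finitely many reals `fᵢ ≥ 0` on a nonempty `s` with
`∑ fᵢ = #s · a` and a real exponent `p ≥ 1`: `#s · a ^ p ≤ ∑ fᵢ ^ p`
(`Real.rpow_arith_mean_le_arith_mean_rpow` with weights `1 / #s`). [folklore] -/
theorem card_mul_rpow_le_sum_rpow {ι : Type*} {s : Finset ι} {f : ι → ℝ} {a p : ℝ} (hp : 1 ≤ p)
    (hs : s.Nonempty) (hf : ∀ i ∈ s, 0 ≤ f i) (hsum : ∑ i ∈ s, f i = s.card * a) :
    (s.card : ℝ) * a ^ p ≤ ∑ i ∈ s, f i ^ p := by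
  have hn : (0 : ℝ) < s.card := by exact_mod_cast hs.card_pos
  -- adapted from Literature/Barriers/MatrixMultiplication/YoungSubgroupBarrierSTPP.lean (uniform-weight Jensen)
  have hJ := Real.rpow_arith_mean_le_arith_mean_rpow s (fun _ => (1 : ℝ) / s.card) f
    (fun _ _ => by positivity)
    (by rw [Finset.sum_const, nsmul_eq_mul, mul_one_div_cancel hn.ne']) hf hp
  rw [← Finset.mul_sum, ← Finset.mul_sum, hsum, ← mul_assoc, one_div_mul_cancel hn.ne',
    one_mul] at hJ
  -- `hJ : a ^ p ≤ 1 / #s * ∑ fᵢ ^ p`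
  have h := mul_le_mul_of_nonneg_left hJ hn.le
  rwa [← mul_assoc, mul_one_div_cancel hn.ne', one_mul] at h

end JensenGain

/-- **Registered sub-goal `jensen_rpow_gain` — the Jensen step of the deficient lever.** For a real
exponent `p ≥ 1`, a constant `c₀ ≥ 0` and finitely many reals `fᵢ ≥ 0` on a nonempty `s` with
`∑ fᵢ = #s · a`: `#s · (c₀ a ^ p − a) ≤ ∑ (c₀ fᵢ ^ p − fᵢ)` (convexity of `x ↦ x ^ p`). [folklore] -/
theorem jensen_rpow_gain : ∀ (p c₀ : ℝ), 1 ≤ p → 0 ≤ c₀ → ∀ (ι : Type) (s : Finset ι) (f : ι → ℝ) (a : ℝ), s.Nonempty → (∀ i ∈ s, 0 ≤ f i) → ∑ i ∈ s, f i = s.card * a → (s.card : ℝ) * (c₀ * a ^ p - a) ≤ ∑ i ∈ s, (c₀ * f i ^ p - f i) := by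
  intro p c₀ hp hc₀ ι s f a hs hf hsum
  have hJ := JensenGain.card_mul_rpow_le_sum_rpow hp hs hf hsum
  have hc := mul_le_mul_of_nonneg_left hJ hc₀
  rw [Finset.sum_sub_distrib, ← Finset.mul_sum, hsum]
  calc (s.card : ℝ) * (c₀ * a ^ p - a) = c₀ * ((s.card : ℝ) * a ^ p) - s.card * a := by ring
    _ ≤ c₀ * ∑ i ∈ s, f i ^ p - s.card * a := by gcongr

end Summit.Schanuel.Schanuel.Cruxes.ApproximationProperty.OrbitInterpolationDeterminant

end
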